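import Literature.MathematicalPhysics.QuantumFieldTheory.MagnenRivasseauSeneor1993.MRS93NestedLattices
import Literature.MathematicalPhysics.QuantumFieldTheory.MagnenRivasseauSeneor1993.MRS93LargeFieldRegions
import HarnessLib

/-!
# Magnen–Rivasseau–Sénéor, *Construction of YM₄ with an infrared cutoff* (CMP 155, 1993), §II.B p.338 tl.8–32: RELEVANT BOXES,
# ANCESTORS and the MAIN SMALL FIELD REGION AS PRINTED — «A box Δ ∈ S_{i,α} is called relevant if there exists a box Δ′ ∈ L_{i,α′}
# such that Δ ⊂ Δ′. In this case we call the smallest such box Δ′ the ancestor of Δ», the cube version «We consider in turn all indices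
# i′ < i … The first rectangular box found in this way is called the ancestor of Δ», «The cubes which have no ancestor are said to be
# in the main small field region», and «SFR(Δ′)» — PROVED to be well defined (the candidates form a chain; existence AND uniqueness of
# the ancestor) and to PARTITION the small field boxes, on the tree's nested anisotropic lattices

finite combinatorics of half-open lattice cells; nothing here is a claim about the Yang–Mills mass gap, about continuum YM₄ on `T⁴`
(with or without infrared cutoff), or about the Clay problem — and nothing of the expansions that PRODUCE the large field region, of
Lemma II.1 («the rarity of large field boxes»), or of the functional integrals of Sects. IV–VI attached to a `Δ′`-small field region is
asserted or formalised

**Citation header (reproduction of PUBLISHED work).** J. Magnen, V. Rivasseau, R. Sénéor, *Construction of YM₄ with an infrared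
cutoff*, Commun. Math. Phys. **155** (1993) 325–383 [MagnenRivasseauSeneor1993], §II.B «The Small Field and Large Field Decomposition»,
p.338 tl.8–32 (re-read on the page image of record `run/shared/lean/pub/lit-balaban/inprint/lit-balaban-p14/renders-cmp155/p14_full_s6.png`;
loci «p.NNN tl.k» = journal page ∕ text-layer line of `paper:magnen1993-cmp155-mrs-ym4-infrared-cutoff`, PDF page = journal page − 324).
Cell pub-balaban-gaps (YM blitz, track G3), seat mrs-lit-2 (gen 18, file 49); companion record
`run/shared/lean/pub/pub-balaban-gaps/g3/MRS-AS-PRINTED-estimates.md`. Siblings whose vocabulary is USED, not re-typed: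
`…MRS93LargeFieldRegions` (mrs-lit-1, gen 17: `LargeFieldRegion.BoxLabel = (i, α) × corner`, `BoxLabel.toSet = PhaseCells.anisoBox`,
`LargeFieldRegion.mem_anisoBox_iff` — whose module docstring declares the ancestor ∕ relevant-box combinatorics of p.338 tl.9–30 and
the main small field region NOT typed there), `…MRS93NestedLattices` (this seat, file 46: `fineLabels`, `mem_fineLabels_iff`,
`exists_fine_box`, `disjoint_anisoBox`, `card_fineLabels_time`), `…MRS93PhaseCells` (mrs-lit-1: `anisoBox`, `boxSide`).

**What the paper prints (verbatim, p.338 [PDF 14]).**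
* tl.8–14: *«The large field region is called LFR = ⋃_{i,α∈𝐏} L_{i,α}. Its complement is the small field region SFR = ⋃_{i,α∈𝐏} S_{i,α}.
  We are going to introduce relations between the rectangular boxes of SFR and LFR. A box Δ ∈ S_{i,α} is called relevant if there
  exists a box Δ′ ∈ L_{i,α′} such that Δ ⊂ Δ′. In this case we call the smallest such box Δ′ the ancestor of Δ. If this is not the case
  the box Δ, called irrelevant, is divided into M^{i+1−α} boxes of the standard lattice 𝐃_i, and we forget about the corresponding
  division of frequencies on p₀.»*
* tl.20–30: *«From now on, when we consider a small field region it is therefore made of relevant rectangular boxes associated to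
  specific ancestors boxes of large field regions with same index i but lower index α, and of ordinary cubes of 𝐃_i. For these cubes Δ
  we also define a notion of ancestor. We consider in turn all indices i′ < i, starting with i′ = i − 1, then i′ = i − 2 and so on, and
  for each such value of i′ we search for the smallest rectangular box of L_{i′,α′} containing the cubic box Δ. The first rectangular box
  found in this way is called the ancestor of Δ. The cubes which have no ancestor are said to be in the main small field region. All the
  small field boxes which have as common ancestor the large field box Δ′ are said to form the small field region SFR(Δ′) associated to
  Δ′, or in short the Δ′-small field region.»*; tl.31–32: *«Because of the rarity of large field boxes (see Lemma II.1), the reader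
  should imagine that most boxes are small field boxes in the main region, i.e. without ancestors.»*

**What is formalised (every statement below is a `theorem` with its proof; `M` a natural number, `M ≥ 2` where labels must be read
off the boxes; the large field region is ANY finite set `L` of box labels, the small field boxes ∕ cubes ANY finite sets `S`, `Q`).**
* §1 NESTING FACTS for the boxes `PhaseCells.anisoBox` of the lattices `𝐃_{i,α}`: `boxSide_le_of_subset`, **`indices_le_of_subset`**
  (a box of `𝐃_{i,α}` lies in a box of `𝐃_{i′,α′}` only if `i′ ≤ i` and `α′ ≤ α`), **`subset_of_mem_of_mem`** (a box of the finer
  lattice sharing a point with a box of the coarser one lies in it), **`subset_of_subset_of_subset`** (two boxes of comparable lattices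
  containing a common box are nested — the candidates for «the smallest such box» form a CHAIN), `eq_of_toSet_eq` (labels are
  determined by the boxes).
* §2 RECTANGULAR BOXES (tl.11–13, tl.20–21): `IsRelevant M L b` («there exists a box Δ′ ∈ L_{i,α′} such that Δ ⊂ Δ′», same spatial
  index `i`), `IsAncestor M L b a` («the smallest such box»: in `L`, same `i`, contains `b`, contained in every other candidate);
  **`exists_isAncestor`** (the candidate with the largest `α′`), **`IsAncestor.unique`**, `existsUnique_isAncestor`;
  `IsAncestor.index_le` ∕ **`IsAncestor.index_lt`** («same index i but lower index α»: `α′ ≤ α`, and `α′ < α` when `b ∉ L`).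
* §3 CUBES (tl.23–27): `IsCubeAncestor M L b a` (in `L`, spatial index `i′ < i` maximal among the large field boxes containing `b` —
  «the first rectangular box found» scanning `i′ = i − 1, i − 2, …` —, and smallest among those at that `i′`), `InMainRegion M L b`
  («no ancestor»: no large field box of lower spatial index contains `b`); **`exists_isCubeAncestor`** (outside the main region),
  **`IsCubeAncestor.unique`**, `existsUnique_isCubeAncestor`, `inMainRegion_iff_forall_not_isCubeAncestor`.
* §4 THE REGIONS (tl.27–30): `sfrRect M L S a`, `sfrCube M L Q a` (the boxes of `S`, resp. cubes of `Q`, whose ancestor is `a` = «SFR(Δ′)»),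
  `mainRegion M L Q`; **`disjoint_sfrRect`**, **`disjoint_sfrCube`**, `disjoint_mainRegion_sfrCube`;
  **`filter_isRelevant_eq_biUnion_sfrRect`** (the relevant boxes of `S` = ⨆_{Δ′∈L} SFR(Δ′)), **`eq_mainRegion_union_biUnion_sfrCube`**
  (the cubes `Q` = main region ⊔ ⨆_{Δ′∈L} SFR(Δ′)), `card_eq_card_mainRegion_add_sum`.
* §5 THE COUNT of tl.13–14 with a precision note: `card_cubes_in_box` (a box of `𝐃_{i,α}`, `α ≤ i`, contains `M^{i−α}` cubes of
  `𝐃_{i,i}`), `card_finestTimeBoxes_in_box` (and `M^{i+1−α}` boxes of `𝐃_{i,i+1}`) — see (ad).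
* §6 WITH THE TYPED REGIONS of `…MRS93LargeFieldRegions` (`L = lfrBox (𝐃₁, 𝐃₂)` with its corridors, `b ∈ sfrBox`, «SFR is then
  automatically the complement of LFR» p.339 tl.10): `IsAncestor.index_lt_of_mem_sfrBox`, `IsCubeAncestor.ne_of_mem_sfrBox`.

**Reading conventions.** (i) A box is a label `((i, α), k) : LargeFieldRegion.BoxLabel`; «Δ ⊂ Δ′» = inclusion of the half-open sets
`BoxLabel.toSet` (for boxes of these lattices proper inclusion and inclusion differ only by equality, excluded whenever `Δ ∈ SFR`,
`Δ′ ∈ LFR` — `IsAncestor.index_lt`). (ii) «a box Δ′ ∈ L_{i,α′}» = a member of `L` with the same FIRST index `i` (any `α′`); the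
ordering of candidates is by inclusion, which §1 identifies with the ordering of `α′`. (iii) «We consider in turn all indices i′ < i,
starting with i′ = i − 1» = maximise `i′` over the large field boxes of lower index containing the cube, then «the smallest» at that
`i′`; the print applies this to cubes of `𝐃_i` — the definitions are stated for any box `b` (a cube is `α = i`). (iv) `L`, `S`, `Q`
are arbitrary finite sets of labels: membership in 𝐏, complementarity of SFR ∕ LFR and the protection corridors (mrs-lit-1's
`LargeFieldRegion.lfr` ∕ `sfr`) are not needed for the statements and are not assumed; `M ≥ 2` is needed exactly where a label is read
off a set (`eq_of_toSet_eq`, `indices_le_of_subset`).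

**As-printed precision (ad) (recorded, NOT adjudicated; nothing depends on it).** tl.13–14 prints «divided into M^{i+1−α} boxes of the
standard lattice 𝐃_i». With the lattices of p.335 (spatial side `M^{−i}`, time side `M^{−α}`, `α ≤ i + 1` by p.334 «between N_i and
i+1») a box of `𝐃_{i,α}` contains `M^{i+1−α}` boxes of the finest time slice `𝐃_{i,i+1}` (`card_finestTimeBoxes_in_box`) and `M^{i−α}`
CUBES of side `M^{−i}` (`card_cubes_in_box`); which of the two «the standard lattice 𝐃_i» denotes («ordinary cubes of 𝐃_i», tl.22,
suggests the cubes) is left open here — both counts are theorems.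

**What is NOT claimed.** The expansions (II.25) ∕ (II.29a) producing `L` (mrs-lit-1's `chiLFR` outcomes), the corridors, Lemma II.1
and the «rarity» sentence tl.31–32 (quoted, not formalised), the division of irrelevant boxes as an operation on the expansion («we
forget about the corresponding division of frequencies on p₀»), anything of Sects. IV–VI («how the functional integrals corresponding to
a Δ-small field region give a non-trivial contribution»). Nothing here bears on Bałaban's papers.
-/

noncomputable section

open Set
open scoped Classical

namespace Literature.MathematicalPhysics.QuantumFieldTheory.MagnenRivasseauSeneor1993

namespace Ancestors

open PhaseCells (anisoBox boxSide boxSide_pos)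
open LargeFieldRegion (BoxLabel)

variable {M : ℕ}

/-! ## §1 Boxes of the nested lattices: containment forces the indices, a common point forces containment -/

/-- Boxes are nonempty (`M > 0`). [cite: MagnenRivasseauSeneor1993, §II.B p.335 tl.16–19] -/
theorem anisoBox_nonempty (hM : 0 < M) (i : ℕ) (α : ℤ) (k : Fin 4 → ℤ) : (anisoBox (M : ℝ) i α k).Nonempty := by
  have hMr : (0 : ℝ) < M := by exact_mod_cast hM
  rw [PhaseCells.anisoBox, univ_pi_nonempty_iff]
  exact fun μ => nonempty_Ico.2 (by nlinarith [boxSide_pos hMr i α μ])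

/-- If a box of `𝐃_{i,α}` lies in a box of `𝐃_{i′,α′}` then, direction by direction, its side is at most the other's.
[cite: MagnenRivasseauSeneor1993, §II.B p.335 tl.16–19] -/
theorem boxSide_le_of_subset (hM : 0 < M) {i i' : ℕ} {α α' : ℤ} {k k' : Fin 4 → ℤ}
    (h : anisoBox (M : ℝ) i α k ⊆ anisoBox (M : ℝ) i' α' k') (μ : Fin 4) :
    boxSide (M : ℝ) i α μ ≤ boxSide (M : ℝ) i' α' μ := by
  have hMr : (0 : ℝ) < M := by exact_mod_cast hM
  have hne := anisoBox_nonempty hM i α k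
  rw [PhaseCells.anisoBox, PhaseCells.anisoBox, pi_subset_pi_iff] at h
  rcases h with h | h
  · have hμ := h μ (mem_univ μ)
    have ht := boxSide_pos hMr i α μ
    rw [Ico_subset_Ico_iff (by nlinarith)] at hμ
    nlinarith [hμ.1, hμ.2]
  · exact absurd h (by rw [← PhaseCells.anisoBox]; exact hne.ne_empty)

/-- **Containment forces the indices** (`M ≥ 2`): a box of `𝐃_{i,α}` can lie in a box of `𝐃_{i′,α′}` only if `i′ ≤ i` and
`α′ ≤ α` — in particular an ancestor has «lower index α» (p.338 tl.20–21). [cite: MagnenRivasseauSeneor1993, §II.B p.338 tl.11–13,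
tl.20–21] -/
theorem indices_le_of_subset (hM : 1 < M) {i i' : ℕ} {α α' : ℤ} {k k' : Fin 4 → ℤ}
    (h : anisoBox (M : ℝ) i α k ⊆ anisoBox (M : ℝ) i' α' k') : i' ≤ i ∧ α' ≤ α := by
  have hM0 : 0 < M := lt_trans zero_lt_one hM
  have hMr : (1 : ℝ) < M := by exact_mod_cast hM
  have h0 := boxSide_le_of_subset hM0 h 0
  have h1 := boxSide_le_of_subset hM0 h 1
  simp only [PhaseCells.boxSide, if_true] at h0
  simp only [PhaseCells.boxSide, Fin.one_eq_zero_iff, OfNat.ofNat_ne_one, if_false] at h1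
  rw [zpow_le_zpow_iff_right₀ hMr] at h0 h1
  constructor <;> omega

/-- **A common point forces containment**: if a box of the finer lattice `𝐃_{i,α}` and a box of the coarser `𝐃_{i′,α′}` (`i′ ≤ i`,
`α′ ≤ α`) share a point, the first lies in the second («refinements of a fixed lattice»).
[cite: MagnenRivasseauSeneor1993, §II.B p.335 tl.16–19] -/
theorem subset_of_mem_of_mem (hM : 0 < M) {i i' : ℕ} (hi : i' ≤ i) {α α' : ℤ} (hα : α' ≤ α) {k k' : Fin 4 → ℤ}
    {x : Fin 4 → ℝ} (hx : x ∈ anisoBox (M : ℝ) i α k) (hx' : x ∈ anisoBox (M : ℝ) i' α' k') :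
    anisoBox (M : ℝ) i α k ⊆ anisoBox (M : ℝ) i' α' k' := by
  have hMr : (0 : ℝ) < M := by exact_mod_cast hM
  obtain ⟨k₀, hk₀, hxk₀⟩ := NestedLattices.exists_fine_box hM hi hα k' hx'
  have : k₀ = k := ((LargeFieldRegion.mem_anisoBox_iff hMr).1 hxk₀).trans ((LargeFieldRegion.mem_anisoBox_iff hMr).1 hx).symm
  subst this
  exact (NestedLattices.mem_fineLabels_iff hM hi hα k₀ k').1 hk₀

/-- **Two boxes containing a common box are nested**: if `Δ ⊆ Δ₁ ∈ 𝐃_{i₁,α₁}` and `Δ ⊆ Δ₂ ∈ 𝐃_{i₂,α₂}` with `(i₁, α₁) ≤ (i₂, α₂)`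
componentwise, then `Δ₂ ⊆ Δ₁` — so the large field boxes containing a given box form a CHAIN and «the smallest such box» (p.338 tl.12)
makes sense. [cite: MagnenRivasseauSeneor1993, §II.B p.338 tl.11–13, tl.23–26] -/
theorem subset_of_subset_of_subset (hM : 0 < M) {i i₁ i₂ : ℕ} {α α₁ α₂ : ℤ} {k k₁ k₂ : Fin 4 → ℤ}
    (hi : i₁ ≤ i₂) (hα : α₁ ≤ α₂) (h₁ : anisoBox (M : ℝ) i α k ⊆ anisoBox (M : ℝ) i₁ α₁ k₁)
    (h₂ : anisoBox (M : ℝ) i α k ⊆ anisoBox (M : ℝ) i₂ α₂ k₂) :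
    anisoBox (M : ℝ) i₂ α₂ k₂ ⊆ anisoBox (M : ℝ) i₁ α₁ k₁ := by
  obtain ⟨x, hx⟩ := anisoBox_nonempty hM i α k
  exact subset_of_mem_of_mem hM hi hα (h₂ hx) (h₁ hx)

/-- **Labels are determined by the boxes** (`M ≥ 2`): equal boxes have equal labels.
[cite: MagnenRivasseauSeneor1993, §II.B p.335 tl.16–19] -/
theorem eq_of_toSet_eq (hM : 1 < M) {b b' : BoxLabel} (h : b.toSet (M : ℝ) = b'.toSet (M : ℝ)) : b = b' := by
  have hM0 : 0 < M := lt_trans zero_lt_one hM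
  have hMr : (0 : ℝ) < M := by exact_mod_cast hM0
  obtain ⟨⟨i, α⟩, k⟩ := b
  obtain ⟨⟨i', α'⟩, k'⟩ := b'
  simp only [LargeFieldRegion.BoxLabel.toSet] at h
  have h1 := indices_le_of_subset hM h.subset
  have h2 := indices_le_of_subset hM h.symm.subset
  obtain ⟨rfl, rfl⟩ : i = i' ∧ α = α' := ⟨le_antisymm h2.1 h1.1, le_antisymm h2.2 h1.2⟩
  by_cases hk : k = k'
  · subst hk; rfl
  · exfalso
    obtain ⟨x, hx⟩ := anisoBox_nonempty hM0 i α k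
    exact Set.disjoint_left.1 (NestedLattices.disjoint_anisoBox hMr i α hk) hx (h ▸ hx)

/-! ## §2 «relevant» boxes and THE ancestor of a rectangular small field box (p.338 tl.11–13) -/

/-- **«A box Δ ∈ S_{i,α} is called relevant if there exists a box Δ′ ∈ L_{i,α′} such that Δ ⊂ Δ′»** — for a set `L` of large field
boxes (labels) and a box `b`: a large field box WITH THE SAME SPATIAL INDEX `i` contains it. [cite: MagnenRivasseauSeneor1993,
§II.B p.338 tl.11–12] -/
def IsRelevant (M : ℕ) (L : Finset BoxLabel) (b : BoxLabel) : Prop :=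
  ∃ c ∈ L, c.1.1 = b.1.1 ∧ b.toSet (M : ℝ) ⊆ c.toSet (M : ℝ)

/-- **«In this case we call the smallest such box Δ′ the ancestor of Δ»**: `a` is an ancestor of `b` iff it is a large field box with
the same index `i` containing `b` and contained in every other such box. [cite: MagnenRivasseauSeneor1993, §II.B p.338 tl.12–13] -/
def IsAncestor (M : ℕ) (L : Finset BoxLabel) (b a : BoxLabel) : Prop :=
  a ∈ L ∧ a.1.1 = b.1.1 ∧ b.toSet (M : ℝ) ⊆ a.toSet (M : ℝ) ∧
    ∀ c ∈ L, c.1.1 = b.1.1 → b.toSet (M : ℝ) ⊆ c.toSet (M : ℝ) → a.toSet (M : ℝ) ⊆ c.toSet (M : ℝ)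

/-- An ancestor witnesses relevance. [cite: MagnenRivasseauSeneor1993, §II.B p.338 tl.11–13] -/
theorem IsAncestor.isRelevant {L : Finset BoxLabel} {b a : BoxLabel} (h : IsAncestor M L b a) : IsRelevant M L b :=
  ⟨a, h.1, h.2.1, h.2.2.1⟩

/-- **Existence: every relevant box has an ancestor** (`M ≥ 2`) — the candidate with the largest time index `α′`, which by §1 lies in
all the others. [cite: MagnenRivasseauSeneor1993, §II.B p.338 tl.11–13] -/
theorem exists_isAncestor (hM : 1 < M) {L : Finset BoxLabel} {b : BoxLabel} (h : IsRelevant M L b) :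
    ∃ a, IsAncestor M L b a := by
  have hM0 : 0 < M := lt_trans zero_lt_one hM
  set C : Finset BoxLabel := L.filter (fun c => c.1.1 = b.1.1 ∧ b.toSet (M : ℝ) ⊆ c.toSet (M : ℝ)) with hC
  have hCne : C.Nonempty := by
    obtain ⟨c, hcL, hci, hcs⟩ := h
    exact ⟨c, Finset.mem_filter.2 ⟨hcL, hci, hcs⟩⟩
  obtain ⟨a, haC, hamax⟩ := Finset.exists_max_image C (fun c => c.1.2) hCne
  obtain ⟨haL, hai, has⟩ := Finset.mem_filter.1 haC
  refine ⟨a, haL, hai, has, fun c hcL hci hcs => ?_⟩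
  have hle : c.1.2 ≤ a.1.2 := hamax c (Finset.mem_filter.2 ⟨hcL, hci, hcs⟩)
  obtain ⟨⟨ia, αa⟩, ka⟩ := a
  obtain ⟨⟨ic, αc⟩, kc⟩ := c
  obtain ⟨⟨ib, αb⟩, kb⟩ := b
  simp only [LargeFieldRegion.BoxLabel.toSet] at has hcs hai hci hle ⊢
  subst hai; subst hci
  exact subset_of_subset_of_subset hM0 le_rfl hle hcs has

/-- **Uniqueness of THE ancestor** (`M ≥ 2`) — two smallest containing boxes contain each other, hence coincide as sets, hence as
labels. [cite: MagnenRivasseauSeneor1993, §II.B p.338 tl.12–13] -/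
theorem IsAncestor.unique (hM : 1 < M) {L : Finset BoxLabel} {b a a' : BoxLabel} (h : IsAncestor M L b a)
    (h' : IsAncestor M L b a') : a = a' :=
  eq_of_toSet_eq hM (Subset.antisymm (h.2.2.2 a' h'.1 h'.2.1 h'.2.2.1) (h'.2.2.2 a h.1 h.2.1 h.2.2.1))

/-- So a relevant box has EXACTLY ONE ancestor. [cite: MagnenRivasseauSeneor1993, §II.B p.338 tl.11–13] -/
theorem existsUnique_isAncestor (hM : 1 < M) {L : Finset BoxLabel} {b : BoxLabel} (h : IsRelevant M L b) :
    ∃! a, IsAncestor M L b a := by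
  obtain ⟨a, ha⟩ := exists_isAncestor hM h
  exact ⟨a, ha, fun a' ha' => ha'.unique hM ha⟩

/-- **«ancestors boxes of large field regions with same index i but lower index α»**: the ancestor has `α′ ≤ α`, and `α′ < α` as soon
as the box itself is not a large field box (e.g. a small field box: `SFR` is the complement of `LFR`). [cite: MagnenRivasseauSeneor1993,
§II.B p.338 tl.20–21] -/
theorem IsAncestor.index_le (hM : 1 < M) {L : Finset BoxLabel} {b a : BoxLabel} (h : IsAncestor M L b a) :
    a.1.1 = b.1.1 ∧ a.1.2 ≤ b.1.2 :=
  ⟨h.2.1, (indices_le_of_subset hM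
    (show anisoBox (M : ℝ) b.1.1 b.1.2 b.2 ⊆ anisoBox (M : ℝ) a.1.1 a.1.2 a.2 from h.2.2.1)).2⟩

/-- (strict form) [cite: MagnenRivasseauSeneor1993, §II.B p.338 tl.20–21] -/
theorem IsAncestor.index_lt (hM : 1 < M) {L : Finset BoxLabel} {b a : BoxLabel} (h : IsAncestor M L b a) (hb : b ∉ L) :
    a.1.2 < b.1.2 := by
  rcases (h.index_le hM).2.lt_or_eq with hlt | heq
  · exact hlt
  · exfalso
    have hM0 : 0 < M := lt_trans zero_lt_one hM
    have hMr : (0 : ℝ) < M := by exact_mod_cast hM0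
    apply hb
    obtain ⟨⟨ia, αa⟩, ka⟩ := a
    obtain ⟨⟨ib, αb⟩, kb⟩ := b
    obtain ⟨haL, hai, has, -⟩ := h
    simp only at hai heq has
    subst hai; subst heq
    simp only [LargeFieldRegion.BoxLabel.toSet] at has
    by_cases hk : kb = ka
    · subst hk; exact haL
    · exfalso
      obtain ⟨x, hx⟩ := anisoBox_nonempty hM0 ia αa kb
      exact Set.disjoint_left.1 (NestedLattices.disjoint_anisoBox hMr ia αa hk) hx (has hx)

/-! ## §3 Cubes of `𝐃_i` and their ancestors: «We consider in turn all indices i′ < i, starting with i′ = i − 1 … The first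
rectangular box found in this way is called the ancestor of Δ» (p.338 tl.23–26) -/

/-- `a` is THE CUBE-ANCESTOR of the box `b`: a large field box of strictly lower spatial index containing `b`, of the LARGEST such index
`i′` («the first rectangular box found», scanning `i′ = i − 1, i − 2, …`), and among those the SMALLEST («we search for the smallest
rectangular box of L_{i′,α′} containing the cubic box Δ»). [cite: MagnenRivasseauSeneor1993, §II.B p.338 tl.23–26] -/
def IsCubeAncestor (M : ℕ) (L : Finset BoxLabel) (b a : BoxLabel) : Prop :=
  a ∈ L ∧ a.1.1 < b.1.1 ∧ b.toSet (M : ℝ) ⊆ a.toSet (M : ℝ) ∧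
    (∀ c ∈ L, c.1.1 < b.1.1 → b.toSet (M : ℝ) ⊆ c.toSet (M : ℝ) → c.1.1 ≤ a.1.1) ∧
    (∀ c ∈ L, c.1.1 = a.1.1 → b.toSet (M : ℝ) ⊆ c.toSet (M : ℝ) → a.toSet (M : ℝ) ⊆ c.toSet (M : ℝ))

/-- **«The cubes which have no ancestor are said to be in the main small field region»**: no large field box of lower spatial index
contains the cube. [cite: MagnenRivasseauSeneor1993, §II.B p.338 tl.26–27] -/
def InMainRegion (M : ℕ) (L : Finset BoxLabel) (b : BoxLabel) : Prop :=
  ∀ c ∈ L, c.1.1 < b.1.1 → ¬ b.toSet (M : ℝ) ⊆ c.toSet (M : ℝ)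

/-- **Existence of the cube-ancestor** for a box outside the main region (`M ≥ 2`): scan for the largest `i′`, then take the candidate
at that `i′` with the largest `α′`; by §1 it is the smallest. [cite: MagnenRivasseauSeneor1993, §II.B p.338 tl.23–26] -/
theorem exists_isCubeAncestor (hM : 1 < M) {L : Finset BoxLabel} {b : BoxLabel} (h : ¬ InMainRegion M L b) :
    ∃ a, IsCubeAncestor M L b a := by
  have hM0 : 0 < M := lt_trans zero_lt_one hM
  simp only [InMainRegion, not_forall, not_not, exists_prop] at h
  obtain ⟨c₀, hc₀L, hc₀i, hc₀s⟩ := h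
  set C : Finset BoxLabel := L.filter (fun c => c.1.1 < b.1.1 ∧ b.toSet (M : ℝ) ⊆ c.toSet (M : ℝ)) with hC
  have hCne : C.Nonempty := ⟨c₀, Finset.mem_filter.2 ⟨hc₀L, hc₀i, hc₀s⟩⟩
  -- the largest index i′ («the first rectangular box found»)
  obtain ⟨m, hmC, hmmax⟩ := Finset.exists_max_image C (fun c => c.1.1) hCne
  set C' : Finset BoxLabel := C.filter (fun c => c.1.1 = m.1.1) with hC'
  have hC'ne : C'.Nonempty := ⟨m, Finset.mem_filter.2 ⟨hmC, rfl⟩⟩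
  -- among those, the largest α′ (the smallest box)
  obtain ⟨a, haC', hamax⟩ := Finset.exists_max_image C' (fun c => c.1.2) hC'ne
  obtain ⟨haC, hai⟩ := Finset.mem_filter.1 haC'
  obtain ⟨haL, hailt, has⟩ := Finset.mem_filter.1 haC
  refine ⟨a, haL, hailt, has, fun c hcL hci hcs => ?_, fun c hcL hci hcs => ?_⟩
  · rw [hai]; exact hmmax c (Finset.mem_filter.2 ⟨hcL, hci, hcs⟩)
  · have hcC : c ∈ C := Finset.mem_filter.2 ⟨hcL, hci ▸ hailt, hcs⟩
    have hle : c.1.2 ≤ a.1.2 := hamax c (Finset.mem_filter.2 ⟨hcC, hci.trans hai⟩)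
    obtain ⟨⟨ia, αa⟩, ka⟩ := a
    obtain ⟨⟨ic, αc⟩, kc⟩ := c
    obtain ⟨⟨ib, αb⟩, kb⟩ := b
    simp only [LargeFieldRegion.BoxLabel.toSet] at has hcs hci hle ⊢
    subst hci
    exact subset_of_subset_of_subset hM0 le_rfl hle hcs has

/-- **Uniqueness of the cube-ancestor** (`M ≥ 2`). [cite: MagnenRivasseauSeneor1993, §II.B p.338 tl.23–26] -/
theorem IsCubeAncestor.unique (hM : 1 < M) {L : Finset BoxLabel} {b a a' : BoxLabel} (h : IsCubeAncestor M L b a)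
    (h' : IsCubeAncestor M L b a') : a = a' := by
  have hi : a.1.1 = a'.1.1 :=
    le_antisymm (h'.2.2.2.1 a h.1 h.2.1 h.2.2.1) (h.2.2.2.1 a' h'.1 h'.2.1 h'.2.2.1)
  exact eq_of_toSet_eq hM (Subset.antisymm (h.2.2.2.2 a' h'.1 hi.symm h'.2.2.1) (h'.2.2.2.2 a h.1 hi h.2.2.1))

/-- A box is in the main region iff it has no cube-ancestor (`M ≥ 2`). [cite: MagnenRivasseauSeneor1993, §II.B p.338 tl.26–27] -/
theorem inMainRegion_iff_forall_not_isCubeAncestor (hM : 1 < M) {L : Finset BoxLabel} {b : BoxLabel} :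
    InMainRegion M L b ↔ ∀ a, ¬ IsCubeAncestor M L b a := by
  constructor
  · intro h a ha; exact h a ha.1 ha.2.1 ha.2.2.1
  · intro h; by_contra hmain
    obtain ⟨a, ha⟩ := exists_isCubeAncestor hM hmain
    exact h a ha

/-- Outside the main region the cube-ancestor exists and is unique. [cite: MagnenRivasseauSeneor1993, §II.B p.338 tl.23–27] -/
theorem existsUnique_isCubeAncestor (hM : 1 < M) {L : Finset BoxLabel} {b : BoxLabel} (h : ¬ InMainRegion M L b) :
    ∃! a, IsCubeAncestor M L b a := by
  obtain ⟨a, ha⟩ := exists_isCubeAncestor hM h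
  exact ⟨a, ha, fun a' ha' => ha'.unique hM ha⟩

/-! ## §4 «All the small field boxes which have as common ancestor the large field box Δ′ are said to form the small field region
SFR(Δ′)» (p.338 tl.27–30): the regions are pairwise disjoint and, with the main region, exhaust the small field boxes -/

/-- `SFR(Δ′)` among a finite set `S` of rectangular small field boxes: those whose ancestor is `a`.
[cite: MagnenRivasseauSeneor1993, §II.B p.338 tl.27–30] -/
def sfrRect (M : ℕ) (L S : Finset BoxLabel) (a : BoxLabel) : Finset BoxLabel := S.filter fun b => IsAncestor M L b a

/-- `SFR(Δ′)` among a finite set `Q` of cubes: those whose cube-ancestor is `a`. [cite: MagnenRivasseauSeneor1993, §II.B p.338 tl.27–30] -/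
def sfrCube (M : ℕ) (L Q : Finset BoxLabel) (a : BoxLabel) : Finset BoxLabel := Q.filter fun b => IsCubeAncestor M L b a

/-- The main small field region among the cubes `Q`. [cite: MagnenRivasseauSeneor1993, §II.B p.338 tl.26–27] -/
def mainRegion (M : ℕ) (L Q : Finset BoxLabel) : Finset BoxLabel := Q.filter fun b => InMainRegion M L b

/-- The regions `SFR(Δ′)` of distinct large field boxes are disjoint (rectangular boxes; `M ≥ 2`).
[cite: MagnenRivasseauSeneor1993, §II.B p.338 tl.27–30] -/
theorem disjoint_sfrRect (hM : 1 < M) (L S : Finset BoxLabel) {a a' : BoxLabel} (h : a ≠ a') :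
    Disjoint (sfrRect M L S a) (sfrRect M L S a') := by
  rw [Finset.disjoint_left]
  intro b hb hb'
  exact h ((Finset.mem_filter.1 hb).2.unique hM (Finset.mem_filter.1 hb').2)

/-- The regions `SFR(Δ′)` of distinct large field boxes are disjoint (cubes; `M ≥ 2`). [cite: MagnenRivasseauSeneor1993, §II.B p.338
tl.27–30] -/
theorem disjoint_sfrCube (hM : 1 < M) (L Q : Finset BoxLabel) {a a' : BoxLabel} (h : a ≠ a') :
    Disjoint (sfrCube M L Q a) (sfrCube M L Q a') := by
  rw [Finset.disjoint_left]
  intro b hb hb'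
  exact h ((Finset.mem_filter.1 hb).2.unique hM (Finset.mem_filter.1 hb').2)

/-- The main region is disjoint from every `SFR(Δ′)` (cubes). [cite: MagnenRivasseauSeneor1993, §II.B p.338 tl.26–30] -/
theorem disjoint_mainRegion_sfrCube (hM : 1 < M) (L Q : Finset BoxLabel) (a : BoxLabel) :
    Disjoint (mainRegion M L Q) (sfrCube M L Q a) := by
  rw [Finset.disjoint_left]
  intro b hb hb'
  exact (inMainRegion_iff_forall_not_isCubeAncestor hM).1 (Finset.mem_filter.1 hb).2 a (Finset.mem_filter.1 hb').2

/-- **The relevant rectangular boxes are exhausted by the regions `SFR(Δ′)`, `Δ′ ∈ L`** (`M ≥ 2`).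
[cite: MagnenRivasseauSeneor1993, §II.B p.338 tl.20–21, tl.27–30] -/
theorem filter_isRelevant_eq_biUnion_sfrRect (hM : 1 < M) (L S : Finset BoxLabel) :
    S.filter (fun b => IsRelevant M L b) = L.biUnion (sfrRect M L S) := by
  ext b
  simp only [Finset.mem_filter, Finset.mem_biUnion, sfrRect]
  constructor
  · rintro ⟨hbS, hrel⟩
    obtain ⟨a, ha⟩ := exists_isAncestor hM hrel
    exact ⟨a, ha.1, hbS, ha⟩
  · rintro ⟨a, -, hbS, ha⟩
    exact ⟨hbS, ha.isRelevant⟩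

/-- **The cubes are exhausted by the main region and the regions `SFR(Δ′)`, `Δ′ ∈ L`** (`M ≥ 2`).
[cite: MagnenRivasseauSeneor1993, §II.B p.338 tl.23–30] -/
theorem eq_mainRegion_union_biUnion_sfrCube (hM : 1 < M) (L Q : Finset BoxLabel) :
    Q = mainRegion M L Q ∪ L.biUnion (sfrCube M L Q) := by
  ext b
  simp only [Finset.mem_union, Finset.mem_filter, Finset.mem_biUnion, mainRegion, sfrCube]
  constructor
  · intro hbQ
    by_cases hmain : InMainRegion M L b
    · exact Or.inl ⟨hbQ, hmain⟩
    · obtain ⟨a, ha⟩ := exists_isCubeAncestor hM hmain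
      exact Or.inr ⟨a, ha.1, hbQ, ha⟩
  · rintro (⟨hbQ, -⟩ | ⟨a, -, hbQ, -⟩) <;> exact hbQ

/-- … so the number of cubes is the size of the main region plus the sizes of the regions `SFR(Δ′)`.
[cite: MagnenRivasseauSeneor1993, §II.B p.338 tl.23–30] -/
theorem card_eq_card_mainRegion_add_sum (hM : 1 < M) (L Q : Finset BoxLabel) :
    Q.card = (mainRegion M L Q).card + ∑ a ∈ L, (sfrCube M L Q a).card := by
  conv_lhs => rw [eq_mainRegion_union_biUnion_sfrCube hM L Q]
  rw [Finset.card_union_of_disjoint, Finset.card_biUnion]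
  · intro a _ a' _ h; exact disjoint_sfrCube hM L Q h
  · rw [Finset.disjoint_biUnion_right]
    intro a _; exact disjoint_mainRegion_sfrCube hM L Q a

/-! ## §5 «the box Δ, called irrelevant, is divided into M^{i+1−α} boxes of the standard lattice 𝐃_i» (p.338 tl.13–14) — the two
counts, recorded with an as-printed precision note -/

/-- A box of `𝐃_{i,α}` with `α ≤ i` contains exactly `M^{i−α}` CUBES of side `M^{−i}` (boxes of `𝐃_{i,i}`; `NestedLattices.fineLabels`
lists the boxes inside for `α ≤ i`, cf. `NestedLattices.mem_fineLabels_iff` — for `α > i` both sides are the trivial `1`) …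
[cite: MagnenRivasseauSeneor1993, §II.B p.338 tl.13–14; §II.B p.335 tl.16–19] -/
theorem card_cubes_in_box (M i α : ℕ) (k' : Fin 4 → ℤ) :
    (NestedLattices.fineLabels M i i i α k').card = M ^ (i - α) :=
  NestedLattices.card_fineLabels_time M i (α := i) (α' := α) k'

/-- … and exactly `M^{i+1−α}` boxes of `𝐃_{i,i+1}` (spatial side `M^{−i}`, time side `M^{−(i+1)}`, the finest time slice `α = i + 1`
of p.334 «between N_i and i+1»; meaningful for `α ≤ i + 1`). PRECISION (ad), recorded not adjudicated: the printed count «M^{i+1−α} boxes of the standard lattice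
𝐃_i» is this one; if «the standard lattice 𝐃_i» denotes the cubes of side `M^{−i}` («ordinary cubes of 𝐃_i», tl.22), their number
is `M^{i−α}` (`card_cubes_in_box`). [cite: MagnenRivasseauSeneor1993, §II.B p.338 tl.13–14; p.334 tl.44–45] -/
theorem card_finestTimeBoxes_in_box (M i α : ℕ) (k' : Fin 4 → ℤ) :
    (NestedLattices.fineLabels M i i (i + 1) α k').card = M ^ (i + 1 - α) := by
  have h := NestedLattices.card_fineLabels_time M i (α := i + 1) (α' := α) k'
  exact_mod_cast h

/-! ## §6 With the typed regions of `…MRS93LargeFieldRegions`: `L = lfrBox`, small field boxes `∈ sfrBox` («SFR is then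
automatically the complement of LFR», p.339 tl.10) -/

/-- For mrs-lit-1's printed regions — `L` the large field region `lfrBox` of an outcome `(𝐃₁, 𝐃₂)` with its protection corridors and `b`
a box of the complementary small field region `sfrBox` — the ancestor of a relevant small field box has STRICTLY lower time index:
«ancestors boxes of large field regions with same index i but lower index α». [cite: MagnenRivasseauSeneor1993, §II.B p.338 tl.20–21;
p.338 tl.8–9] -/
theorem IsAncestor.index_lt_of_mem_sfrBox (hM : 1 < M) {lamT : ℕ → ℝ} {𝓓 D₁ D₂ : Finset BoxLabel} {b a : BoxLabel}
    (h : IsAncestor M (LargeFieldRegion.lfrBox (M : ℝ) lamT 𝓓 D₁ D₂) b a)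
    (hb : b ∈ LargeFieldRegion.sfrBox (M : ℝ) lamT 𝓓 D₁ D₂) : a.1.1 = b.1.1 ∧ a.1.2 < b.1.2 :=
  ⟨h.2.1, h.index_lt hM (LargeFieldRegion.mem_sfr_iff.1 hb).2⟩

/-- … and a small field box is never its own cube-ancestor's equal: the cube-ancestor lies in `lfrBox`, the box in `sfrBox`, and the
two regions are disjoint. [cite: MagnenRivasseauSeneor1993, §II.B p.338 tl.8–9, tl.23–26] -/
theorem IsCubeAncestor.ne_of_mem_sfrBox {lamT : ℕ → ℝ} {𝓓 D₁ D₂ : Finset BoxLabel} {b a : BoxLabel}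
    (h : IsCubeAncestor M (LargeFieldRegion.lfrBox (M : ℝ) lamT 𝓓 D₁ D₂) b a)
    (hb : b ∈ LargeFieldRegion.sfrBox (M : ℝ) lamT 𝓓 D₁ D₂) : a ≠ b := by
  rintro rfl
  exact (LargeFieldRegion.mem_sfr_iff.1 hb).2 h.1

end Ancestors

end Literature.MathematicalPhysics.QuantumFieldTheory.MagnenRivasseauSeneor1993
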